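import Summits.Langlands.Langlands.Statement
import Literature.NumberTheory.GaloisRepresentations.InducedAEUnramified
import Literature.NumberTheory.GaloisRepresentations.FrobeniusPlaces
import HarnessLib

/-!
# Geometricity DESCENDS along a finite layer `L/K`
# (crux `AscentConjugationSolvable`, stmt-Langlands-1094; piece `CyclicPrimeAscent`; lead c3 helper stub H2)

Support file (closes nothing).  Let `K ⊆ L` be number fields, `ℓ` a prime and
`ρ₀ : Γ_K → GL_n(ℚ̄_ℓ)` a framed Galois representation whose restriction `ρ₀|_{Γ_L}`
(`FramedGaloisRep.restrictField`, along `absGaloisRestrict K L`) is geometric over `L`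
(`IsGeometricFramed`: unramified at all but finitely many places and de Rham at every place above `ℓ`
for THE pinned Fontaine data `fontainePstAdicCompletion`).  Then `ρ₀` is geometric over `K`, granted the
de Rham DESCENT schema for the pinned data (Brinon–Conrad 2009, Prop. 6.3.8, "`V` is de Rham as a
`G_K`-representation if and only if it is de Rham as a `G_{K'}`-representation"; the converse direction of
the tree's named fact `DeRhamBaseChange`), which enters as the explicit first hypothesis.

What is PROVED here is the unramified half (Serre 1968, Ch. I §2.1; Neukirch I §9 (9.4)–(9.6)):

* `isUnramifiedAt_of_restrictField_of_forall_inertia_le` — at a place `v` of `K` all of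
  whose inertia groups `I_𝔓 ≤ Γ_K`, `𝔓 ∣ v`, lie in `res(Γ_L)` (true for all but finitely many `v`,
  `eventually_forall_inertia_le_range_absGaloisRestrict`: `v` unramified in the Galois closure of `L`;
  NO normality of `L/K` needed), `ρ₀` is unramified as soon as `ρ₀|_{Γ_L}` is unramified at every place
  `w ∣ v` of `L`: an element of `I_𝔓` is `res δ` with `δ ∈ res⁻¹(I_𝔓) = I_𝔔` for the prime `𝔔 = ι 𝔓` of
  `\bar ℤ_L` (`comap_inertia_comap_absIntegersMap`), which lies above a place `w ∣ v`
  (`exists_heightOneSpectrum_of_comap_absIntegersMap_mem_primesAbove`), so `ρ₀ (res δ) = ρ₀|_{Γ_L} δ = 1`.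
* `eventually_isUnramifiedAt_of_restrictField` — hence `ρ₀|_{Γ_L}` unramified almost
  everywhere ⇒ `ρ₀` unramified almost everywhere (the finitely many bad `w` lie above finitely many `v`).

References: J.-P. Serre, *Abelian ℓ-adic representations and elliptic curves* (1968), Ch. I §2.1;
J. Neukirch, *Algebraic Number Theory* (1999), Ch. I §9 (9.4)–(9.6), Ch. III §2 (2.12);
O. Brinon, B. Conrad, *CMI Summer School notes on p-adic Hodge theory* (2009), Prop. 6.3.8.
-/

noncomputable section

set_option linter.dupNamespace false -- project-wide option; `Summit.Langlands.Langlands` is the mandated namespace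

namespace Summit.Langlands.Langlands.Theorems.SmithKummerSeedCyclicPrimeAscent

open scoped MatrixGroups NumberField Classical Matrix Polynomial
open Filter IsDedekindDomain Field
open Literature.NumberTheory.Automorphic Literature.NumberTheory.GaloisRepresentations Literature.NumberTheory.PAdicHodge
open Summit.Langlands

section Unramified

variable {K L : Type} [Field K] [NumberField K] [Field L] [NumberField L] [Algebra K L]
  {A : Type*} [CommRing A] [TopologicalSpace A] {n : ℕ}

/-- **Unramifiedness descends from `Γ_L` at a place whose inertia groups lie in `res(Γ_L)`** (no
normality of `L/K`): if every inertia group `I_𝔓 ≤ Γ_K`, `𝔓 ∣ v`, lies in the image of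
`res : Γ_L → Γ_K` and `σ|_{Γ_L}` is unramified at every place `w ∣ v` of `L`, then `σ` is unramified at
`v`.  For `γ ∈ I_𝔓` write `γ = res δ`; then `δ ∈ res⁻¹(I_𝔓) = I_𝔔` for the prime `𝔔` of `\bar ℤ_L` with
`ι⁻¹ 𝔔 = 𝔓` (`comap_inertia_comap_absIntegersMap`), `𝔔` lies above a place `w ∣ v` of `L`, and
`σ γ = σ|_{Γ_L} δ = 1`.  Neukirch, *Algebraic Number Theory*, Ch. I §9 (9.4)–(9.6); Serre 1968, Ch. I §2.1.
[cite: NeukirchANT1999, Ch. I §9 (9.6)] [cite: SerreAbelianLadic1968, Ch. I §2.1] -/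
theorem isUnramifiedAt_of_restrictField_of_forall_inertia_le
    (σ : FramedGaloisRep K A n) {v : HeightOneSpectrum (𝓞 K)}
    (hI : ∀ 𝔓 ∈ v.primesAbove,
      𝔓.inertia (absoluteGaloisGroup K) ≤ (absGaloisRestrict K L).range)
    (h : ∀ w : HeightOneSpectrum (𝓞 L), w.asIdeal.under (𝓞 K) = v.asIdeal →
      (σ.restrictField L).IsUnramifiedAt w) :
    σ.IsUnramifiedAt v := by
  haveI : Algebra.IsAlgebraic K L := Algebra.IsAlgebraic.tower_top (K := ℚ) K
  intro 𝔓 h𝔓 γ hγ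
  obtain ⟨δ, rfl⟩ := hI 𝔓 h𝔓 hγ
  haveI : 𝔓.IsPrime := h𝔓.1
  obtain ⟨𝔔, h𝔔prime, h𝔔⟩ := exists_isPrime_comap_absIntegersMap_eq K L 𝔓
  haveI := h𝔔prime
  obtain ⟨w, hw, h𝔔w, -⟩ :=
    exists_heightOneSpectrum_of_comap_absIntegersMap_mem_primesAbove (K := K) (M := L)
      (𝔔 := 𝔔) (h𝔔.symm ▸ h𝔓)
  have hδ : δ ∈ 𝔔.inertia (absoluteGaloisGroup L) := by
    rw [← comap_inertia_comap_absIntegersMap K L 𝔔, Subgroup.mem_comap, h𝔔]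
    exact hγ
  have h1 := h w hw 𝔔 h𝔔w δ hδ
  rwa [FramedGaloisRep.restrictField_apply] at h1

/-- **`ρ|_{Γ_L}` unramified almost everywhere ⇒ `ρ` unramified almost everywhere.**  For all but
finitely many places `v` of `K` every inertia group above `v` lies in `res(Γ_L)`
(`eventually_forall_inertia_le_range_absGaloisRestrict`: `v` unramified in the Galois closure of `L`)
and every place `w ∣ v` of `L` is good for `ρ|_{Γ_L}` (the finitely many bad `w` lie above finitely
many `v`); at such `v` the previous lemma applies.  Serre 1968, Ch. I §2.1; Neukirch III §2 (2.12).
[cite: SerreAbelianLadic1968, Ch. I §2.1] [cite: NeukirchANT1999, Ch. I §9 (9.6)] -/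
theorem eventually_isUnramifiedAt_of_restrictField (ρ : FramedGaloisRep K A n)
    (hρ : ∀ᶠ w : HeightOneSpectrum (𝓞 L) in cofinite, (ρ.restrictField L).IsUnramifiedAt w) :
    ∀ᶠ v : HeightOneSpectrum (𝓞 K) in cofinite, ρ.IsUnramifiedAt v := by
  haveI : FiniteDimensional K L := Module.Finite.of_restrictScalars_finite ℚ K L
  have h2 : ∀ᶠ v : HeightOneSpectrum (𝓞 K) in cofinite, ∀ w : HeightOneSpectrum (𝓞 L),
      w.asIdeal.under (𝓞 K) = v.asIdeal → (ρ.restrictField L).IsUnramifiedAt w := by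
    rw [Filter.eventually_cofinite] at hρ ⊢
    refine (hρ.image fun w => w.under (𝓞 K)).subset fun v hv => ?_
    simp only [Set.mem_setOf_eq, not_forall] at hv
    obtain ⟨w, hw, hbad⟩ := hv
    exact ⟨w, hbad, HeightOneSpectrum.ext hw⟩
  filter_upwards [eventually_forall_inertia_le_range_absGaloisRestrict K L, h2] with v hv1 hv2
  exact isUnramifiedAt_of_restrictField_of_forall_inertia_le ρ hv1 hv2

end Unramified

/-- HELPER STUB H2 — **geometricity DESCENDS along the layer** (unramified a.e.: inertia at the places of `K`
unramified in the Galois closure of `L` lies in `res(Γ_L)`, `eventually_forall_inertia_le_range_absGaloisRestrict`,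
and `res⁻¹(I_𝔓) = I_𝔔`, `eventually_isUnramifiedAt_of_restrictField`; de Rham at `v ∣ ℓ`: the
de Rham DESCENT schema for THE pinned Fontaine data, Brinon–Conrad Prop. 6.3.8 "if and only if", supplied as the
explicit first hypothesis — the pinned datum `ReciprocityData.pst R₀ ℓ v hv` IS `fontainePstAdicCompletion v ℓ hv`,
independently of `R₀`): if `ρ₀|_{Γ_L}` is `R`-geometric over `L` then `ρ₀` is `R₀`-geometric over `K`.
[cite: BrinonConrad2009, Prop. 6.3.8] [cite: SerreAbelianLadic1968, Ch. I §2.1] -/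
theorem isGeometricFramed_of_restrictField_of_deRhamDescent : (∀ (K L : Type) [Field K] [NumberField K] [Field L] [NumberField L] [Algebra K L] (ℓ : ℕ) [Fact ℓ.Prime] (n : ℕ) (ρ : Literature.NumberTheory.GaloisRepresentations.FramedGaloisRep K (PadicAlgCl ℓ) n), (∀ (w : IsDedekindDomain.HeightOneSpectrum (NumberField.RingOfIntegers L)) (hw : ((ℓ : ℕ) : NumberField.RingOfIntegers L) ∈ w.asIdeal), (Literature.NumberTheory.PAdicHodge.fontainePstAdicCompletion w ℓ hw).IsDeRhamFramed ((ρ.restrictField L).toLocal w)) → ∀ (v : IsDedekindDomain.HeightOneSpectrum (NumberField.RingOfIntegers K)) (hv : ((ℓ : ℕ) : NumberField.RingOfIntegers K) ∈ v.asIdeal), (Literature.NumberTheory.PAdicHodge.fontainePstAdicCompletion v ℓ hv).IsDeRhamFramed (ρ.toLocal v)) → ∀ (K L : Type) [Field K] [NumberField K] [Field L] [NumberField L] [Algebra K L] (R₀ : ReciprocityData K) (R : ReciprocityData L) (ℓ : ℕ) [Fact ℓ.Prime] (n : ℕ) (ρ₀ : Literature.NumberTheory.GaloisRepresentations.FramedGaloisRep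 K (PadicAlgCl ℓ) n), IsGeometricFramed R (ρ₀.restrictField L) → IsGeometricFramed R₀ ρ₀ := by
  intro hDesc K L _ _ _ _ _ R₀ R ℓ _ n ρ₀ h
  exact ⟨eventually_isUnramifiedAt_of_restrictField ρ₀ h.1,
    fun v hv => hDesc K L ℓ n ρ₀ (fun w hw => h.2 w hw) v hv⟩

end Summit.Langlands.Langlands.Theorems.SmithKummerSeedCyclicPrimeAscent

end
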